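import Mathlib.RepresentationTheory.Semisimple
import Mathlib.LinearAlgebra.Matrix.Charpoly.Coeff
import Mathlib.LinearAlgebra.Matrix.GeneralLinearGroup.Defs
import Mathlib.LinearAlgebra.FiniteDimensional.Lemmas
import Literature.RepresentationTheory.Semisimple.SubrepresentationEquiv
import HarnessLib

/-!
# Semisimplification of two-dimensional matrix representations

For a group homomorphism `ψ : G → GL₂(k)` over a field `k`, the **semisimplification** of the
representation of `G` on `k²`: a homomorphism `ψ' : G → GL₂(k)` whose representation on `k²` is
semisimple, with the same characteristic polynomials `det(X - ψ'(g)) = det(X - ψ(g))` for all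
`g`, and `ker ψ ≤ ker ψ'` (Curtis–Reiner, *Methods of Representation Theory* I, §16B; used in
Deligne–Serre 1974, 6.12: "Soit `φ̃` la semi-simplifiée de `ρ̃_λ`; c'est une représentation
semi-simple ... et qui satisfait à (6.7.1)"). In dimension `2` this is elementary and is PROVED
here: either `k²` is irreducible (hence semisimple), or there is a stable line `k w`, and then
`ψ(g) w = χ₁(g) w`, `χ₂ = det ψ / χ₁`, and `ψ' = diag(χ₁, χ₂)` works (`χ₁(g)` is a root of
`X² - tr ψ(g) X + det ψ(g)` by Cayley–Hamilton).

* `Literature.RepresentationTheory.Semisimple.isSemisimpleRepresentation_diagonal_fin_two` —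
  a representation of `G` on `k²` by diagonal matrices is semisimple.
* `Literature.RepresentationTheory.Semisimple.exists_semisimplification_fin_two` — the
  semisimplification.

## References

* C. W. Curtis, I. Reiner, *Methods of Representation Theory* I, Wiley (1981), §16B.
* P. Deligne, J.-P. Serre, *Formes modulaires de poids 1*, Ann. Sci. ÉNS (4) 7 (1974), 6.12.
-/

noncomputable section

open scoped MatrixGroups

open Matrix Polynomial Module

namespace Literature.RepresentationTheory.Semisimple

variable {k : Type*} [Field k] {G : Type*} [Group G]

/-! ### Lines in `k²` -/

section Lines

/-- A non-zero proper submodule of `k²` is a line: it has dimension `1`. [folklore] -/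
theorem finrank_eq_one_of_ne_bot_of_ne_top {U : Submodule k (Fin 2 → k)} (h0 : U ≠ ⊥)
    (h1 : U ≠ ⊤) : finrank k U = 1 := by
  have h2 : finrank k (Fin 2 → k) = 2 := finrank_fin_fun k
  have hlt : finrank k U < finrank k (Fin 2 → k) := Submodule.finrank_lt h1
  rw [h2] at hlt
  have hpos : 0 < finrank k U :=
    Nat.pos_of_ne_zero fun h ↦ h0 (Submodule.finrank_eq_zero.mp h)
  omega

/-- Two distinct lines of `k²` are complementary. [folklore] -/
theorem isCompl_of_finrank_eq_one {U U' : Submodule k (Fin 2 → k)} (hU : finrank k U = 1)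
    (hU' : finrank k U' = 1) (hne : U ≠ U') : IsCompl U U' := by
  have h2 : finrank k (Fin 2 → k) = 2 := finrank_fin_fun k
  have hinf : U ⊓ U' = ⊥ := by
    by_contra h
    have h1 : finrank k ↥(U ⊓ U') = 1 := by
      have hle : finrank k ↥(U ⊓ U') ≤ 1 := hU ▸ Submodule.finrank_mono inf_le_left
      have hpos : 0 < finrank k ↥(U ⊓ U') := by
        rw [pos_iff_ne_zero]
        exact fun h' ↦ h (Submodule.finrank_eq_zero.mp h')
      omega
    have hUle : U ⊓ U' = U := Submodule.eq_of_le_of_finrank_eq inf_le_left (by rw [h1, hU])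
    have hU'le : U ⊓ U' = U' := Submodule.eq_of_le_of_finrank_eq inf_le_right (by rw [h1, hU'])
    exact hne (hUle.symm.trans hU'le)
  have hsup : U ⊔ U' = ⊤ := by
    apply Submodule.eq_top_of_finrank_eq
    have := Submodule.finrank_sup_add_finrank_inf_eq U U'
    rw [hinf, finrank_bot, add_zero, hU, hU'] at this
    rw [this, h2]
  exact ⟨disjoint_iff.mpr hinf, codisjoint_iff.mpr hsup⟩

end Lines

/-! ### Diagonal representations are semisimple -/

section Diagonal

/-- The coordinate line `k eᵢ ⊆ k²` is stable under every diagonal matrix. [folklore] -/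
theorem diagonal_mulVec_mem_span_single (d : Fin 2 → k) (i : Fin 2) {v : Fin 2 → k}
    (hv : v ∈ k ∙ (Pi.single i 1 : Fin 2 → k)) :
    Matrix.diagonal d *ᵥ v ∈ k ∙ (Pi.single i 1 : Fin 2 → k) := by
  rw [Submodule.mem_span_singleton] at hv ⊢
  obtain ⟨c, rfl⟩ := hv
  refine ⟨c * d i, ?_⟩
  ext j
  simp only [Pi.smul_apply, smul_eq_mul, Matrix.mulVec_smul, Matrix.mulVec_single_one]
  by_cases hij : j = i
  · subst hij; simp
  · simp [hij]

/-- **A representation of `G` on `k²` by diagonal matrices is semisimple**: every stable subspace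
has a stable complement (the coordinate lines are stable, and a stable line distinct from
`k e₂` is complemented by `k e₂`). [folklore] -/
theorem isSemisimpleRepresentation_diagonal_fin_two (ψ : G →* GL (Fin 2) k)
    (hψ : ∀ g, ∃ d : Fin 2 → k, ((ψ g : GL (Fin 2) k) : Matrix (Fin 2) (Fin 2) k) = Matrix.diagonal d) :
    Representation.IsSemisimpleRepresentation
      ((Representation.ofDistribMulAction k (GL (Fin 2) k) (Fin 2 → k)).comp ψ) := by
  classical
  set R := (Representation.ofDistribMulAction k (GL (Fin 2) k) (Fin 2 → k)).comp ψ with hR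
  have hRapply : ∀ (g : G) (v : Fin 2 → k),
      R g v = ((ψ g : GL (Fin 2) k) : Matrix (Fin 2) (Fin 2) k) *ᵥ v := fun _ _ ↦ rfl
  -- the coordinate lines as subrepresentations
  let L : Fin 2 → Subrepresentation R := fun i ↦
    ⟨k ∙ (Pi.single i 1 : Fin 2 → k), fun g v hv ↦ by
      obtain ⟨d, hd⟩ := hψ g
      rw [hRapply, hd]
      exact diagonal_mulVec_mem_span_single d i hv⟩
  have hLsub : ∀ i, (L i).toSubmodule = k ∙ (Pi.single i 1 : Fin 2 → k) := fun _ ↦ rfl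
  have hLrank : ∀ i, finrank k (L i).toSubmodule = 1 := fun i ↦ by
    rw [hLsub]; exact finrank_span_singleton (by simp)
  have hL01 : (L 0).toSubmodule ≠ (L 1).toSubmodule := by
    intro h
    have hmem : (Pi.single 0 1 : Fin 2 → k) ∈ (L 1).toSubmodule := h ▸ Submodule.mem_span_singleton_self _
    rw [hLsub, Submodule.mem_span_singleton] at hmem
    obtain ⟨c, hc⟩ := hmem
    have := congr_fun hc 0
    simp at this
  -- complements, transported to subrepresentations
  have hcompl : ∀ U U' : Subrepresentation R, IsCompl U.toSubmodule U'.toSubmodule → IsCompl U U' :=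
    fun U U' h ↦ Subrepresentation.isCompl_iff.mpr h
  refine ⟨fun U ↦ ?_⟩
  by_cases h0 : U.toSubmodule = ⊥
  · refine ⟨⊤, hcompl _ _ ?_⟩
    rw [h0]; exact isCompl_bot_top
  by_cases h1 : U.toSubmodule = ⊤
  · refine ⟨⊥, hcompl _ _ ?_⟩
    rw [h1]; exact isCompl_top_bot
  have hU : finrank k U.toSubmodule = 1 := finrank_eq_one_of_ne_bot_of_ne_top h0 h1
  by_cases hU1 : U.toSubmodule = (L 1).toSubmodule
  · refine ⟨L 0, hcompl _ _ ?_⟩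
    rw [hU1]
    exact isCompl_of_finrank_eq_one (hLrank 1) (hLrank 0) hL01.symm
  · exact ⟨L 1, hcompl _ _ (isCompl_of_finrank_eq_one hU (hLrank 1) hU1)⟩

end Diagonal

/-! ### The semisimplification -/

section Semisimplification

/-- An eigenvalue of a `2 × 2` matrix is a root of `X² - tr X + det` (the matrix `M - a` is
singular). [folklore] -/
theorem sq_sub_trace_mul_add_det_eq_zero {M : Matrix (Fin 2) (Fin 2) k} {w : Fin 2 → k}
    {a : k} (hw : w ≠ 0) (h : M *ᵥ w = a • w) : a ^ 2 - M.trace * a + M.det = 0 := by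
  have hker : (M - a • (1 : Matrix (Fin 2) (Fin 2) k)) *ᵥ w = 0 := by
    rw [Matrix.sub_mulVec, Matrix.smul_mulVec, Matrix.one_mulVec, h, sub_self]
  have hdet : (M - a • (1 : Matrix (Fin 2) (Fin 2) k)).det = 0 :=
    Matrix.exists_mulVec_eq_zero_iff.mp ⟨w, hw, hker⟩
  rw [Matrix.det_fin_two] at hdet
  rw [Matrix.trace_fin_two, Matrix.det_fin_two]
  simp only [Matrix.sub_apply, Matrix.smul_apply, Matrix.one_apply_eq, ne_eq, zero_ne_one,
    not_false_eq_true, Matrix.one_apply_ne, one_ne_zero, smul_eq_mul, mul_one, mul_zero,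
    sub_zero] at hdet
  linear_combination hdet

/-- The diagonal matrix `diag(u₀, u₁)` as an element of `GL₂(k)`, for units `u₀, u₁`, and its
multiplicativity: the homomorphism `kˣ × kˣ → GL₂(k)`. [folklore] -/
theorem exists_diagonalHom :
    ∃ D : kˣ × kˣ →* GL (Fin 2) k, ∀ u : kˣ × kˣ,
      ((D u : GL (Fin 2) k) : Matrix (Fin 2) (Fin 2) k) = Matrix.diagonal ![(u.1 : k), (u.2 : k)] := by
  classical
  let d : kˣ × kˣ → Matrix (Fin 2) (Fin 2) k := fun u ↦ Matrix.diagonal ![(u.1 : k), (u.2 : k)]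
  have hd_mul : ∀ u v, d (u * v) = d u * d v := fun u v ↦ by
    simp only [d, Prod.fst_mul, Prod.snd_mul, Units.val_mul, Matrix.diagonal_mul_diagonal]
    congr 1
    ext i; fin_cases i <;> rfl
  have hd_one : d 1 = 1 := by
    simp only [d, Prod.fst_one, Prod.snd_one, Units.val_one]
    rw [← Matrix.diagonal_one]
    congr 1
    ext i; fin_cases i <;> rfl
  refine ⟨{ toFun := fun u ↦ ⟨d u, d u⁻¹, by rw [← hd_mul, mul_inv_cancel, hd_one],
      by rw [← hd_mul, inv_mul_cancel, hd_one]⟩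
            map_one' := Units.ext hd_one
            map_mul' := fun u v ↦ Units.ext (hd_mul u v) }, fun u ↦ rfl⟩

/-- **Semisimplification in dimension `2`** (Curtis–Reiner I §16B; Deligne–Serre 1974, 6.12).
For every homomorphism `ψ : G → GL₂(k)` there is `ψ' : G → GL₂(k)` whose representation on `k²`
is semisimple, with the same characteristic polynomials, `det(X - ψ'(g)) = det(X - ψ(g))`, and
with `ker ψ ≤ ker ψ'`. [cite: DeligneSerreASENS1974, 6.12] -/
theorem exists_semisimplification_fin_two (ψ : G →* GL (Fin 2) k) :
    ∃ ψ' : G →* GL (Fin 2) k,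
      Representation.IsSemisimpleRepresentation
        ((Representation.ofDistribMulAction k (GL (Fin 2) k) (Fin 2 → k)).comp ψ') ∧
      (∀ g, ((ψ' g : GL (Fin 2) k) : Matrix (Fin 2) (Fin 2) k).charpoly =
        ((ψ g : GL (Fin 2) k) : Matrix (Fin 2) (Fin 2) k).charpoly) ∧
      ψ.ker ≤ ψ'.ker := by
  classical
  set R := (Representation.ofDistribMulAction k (GL (Fin 2) k) (Fin 2 → k)).comp ψ with hR
  have hRapply : ∀ (g : G) (v : Fin 2 → k),
      R g v = ((ψ g : GL (Fin 2) k) : Matrix (Fin 2) (Fin 2) k) *ᵥ v := fun _ _ ↦ rfl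
  by_cases hirr : Representation.IsIrreducible R
  · -- irreducible, hence semisimple
    haveI : IsSimpleOrder (Subrepresentation R) := hirr
    exact ⟨ψ, (inferInstance : ComplementedLattice (Subrepresentation R)), fun _ ↦ rfl, le_rfl⟩
  -- a stable line `k w`
  have hbot : (⊥ : Subrepresentation R).toSubmodule = ⊥ := rfl
  have htop : (⊤ : Subrepresentation R).toSubmodule = ⊤ := rfl
  have hbt : (⊥ : Subrepresentation R) ≠ ⊤ := by
    intro h
    have h' := congrArg Subrepresentation.toSubmodule h
    rw [hbot, htop] at h'
    exact bot_ne_top h'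
  obtain ⟨W, hW0, hW1⟩ : ∃ W : Subrepresentation R, W ≠ ⊥ ∧ W ≠ ⊤ := by
    by_contra hcon
    push Not at hcon
    haveI : Nontrivial (Subrepresentation R) := ⟨⟨⊥, ⊤, hbt⟩⟩
    exact hirr ⟨fun W ↦ or_iff_not_imp_left.mpr (hcon W)⟩
  have hW0' : W.toSubmodule ≠ ⊥ := fun h ↦ hW0 (Subrepresentation.toSubmodule_injective
    (by rw [h, hbot]))
  have hW1' : W.toSubmodule ≠ ⊤ := fun h ↦ hW1 (Subrepresentation.toSubmodule_injective
    (by rw [h, htop]))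
  have hWrank : finrank k W.toSubmodule = 1 := finrank_eq_one_of_ne_bot_of_ne_top hW0' hW1'
  obtain ⟨w, hwW, hw0⟩ := Submodule.exists_mem_ne_zero_of_ne_bot hW0'
  -- every element of `W` is a multiple of `w`
  have hmult : ∀ v ∈ W.toSubmodule, ∃ c : k, c • w = v := by
    intro v hv
    have h1 := (finrank_eq_one_iff_of_nonzero' (⟨w, hwW⟩ : W.toSubmodule)
      (by exact_mod_cast Subtype.coe_ne_coe.mp hw0 : (⟨w, hwW⟩ : W.toSubmodule) ≠ 0)).mp hWrank ⟨v, hv⟩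
    obtain ⟨c, hc⟩ := h1
    exact ⟨c, by simpa using congrArg Subtype.val hc⟩
  -- the eigencharacter `χ₁`
  have hex : ∀ g : G, ∃ c : k, c • w = R g w := fun g ↦ hmult _ (W.apply_mem_toSubmodule g hwW)
  choose χ hχ using hex
  have hχne : ∀ g, χ g ≠ 0 := by
    intro g hg
    have h1 : R g w = 0 := by rw [← hχ g, hg, zero_smul]
    have h2 : w = 0 := by
      have := congrArg (R g⁻¹) h1
      rwa [map_zero, ← Module.End.mul_apply, ← map_mul, inv_mul_cancel, map_one,
        Module.End.one_apply] at this
    exact hw0 h2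
  have hχmul : ∀ g h, χ (g * h) = χ g * χ h := by
    intro g h
    apply smul_left_injective k hw0
    change χ (g * h) • w = (χ g * χ h) • w
    rw [hχ, map_mul, Module.End.mul_apply, ← hχ h, map_smul, ← hχ g, smul_smul, mul_comm]
  have hχone : χ 1 = 1 := by
    apply smul_left_injective k hw0
    change χ 1 • w = (1 : k) • w
    rw [hχ, map_one, Module.End.one_apply, one_smul]
  let χ₁ : G →* kˣ :=
    { toFun := fun g ↦ Units.mk0 (χ g) (hχne g)
      map_one' := Units.ext hχone
      map_mul' := fun g h ↦ Units.ext (hχmul g h) }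
  have hχ₁ : ∀ g, ((χ₁ g : kˣ) : k) = χ g := fun _ ↦ rfl
  -- the determinant character and `χ₂ = det / χ₁`
  let δ : G →* kˣ := Matrix.GeneralLinearGroup.det.comp ψ
  have hδ : ∀ g, ((δ g : kˣ) : k) = ((ψ g : GL (Fin 2) k) : Matrix (Fin 2) (Fin 2) k).det :=
    fun _ ↦ rfl
  let χ₂ : G →* kˣ := δ * χ₁⁻¹
  have hχ₂ : ∀ g, ((χ₂ g : kˣ) : k) = ((ψ g : GL (Fin 2) k) : Matrix (Fin 2) (Fin 2) k).det * (χ g)⁻¹ :=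
    fun g ↦ by simp [χ₂, hδ, hχ₁]
  -- the eigenvalue relation: `χ(g)² - tr χ(g) + det = 0`
  have hroot : ∀ g, χ g ^ 2 - ((ψ g : GL (Fin 2) k) : Matrix (Fin 2) (Fin 2) k).trace * χ g +
      ((ψ g : GL (Fin 2) k) : Matrix (Fin 2) (Fin 2) k).det = 0 := fun g ↦
    sq_sub_trace_mul_add_det_eq_zero hw0 (by rw [← hRapply, ← hχ g])
  -- `ψ' = diag(χ₁, χ₂)`
  obtain ⟨D, hD⟩ := exists_diagonalHom (k := k)
  let ψ' : G →* GL (Fin 2) k := D.comp (χ₁.prod χ₂)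
  have hψ' : ∀ g, ((ψ' g : GL (Fin 2) k) : Matrix (Fin 2) (Fin 2) k) =
      Matrix.diagonal ![χ g, ((ψ g : GL (Fin 2) k) : Matrix (Fin 2) (Fin 2) k).det * (χ g)⁻¹] := by
    intro g
    change ((D (χ₁ g, χ₂ g) : GL (Fin 2) k) : Matrix (Fin 2) (Fin 2) k) = _
    rw [hD, hχ₁, hχ₂]
  refine ⟨ψ', isSemisimpleRepresentation_diagonal_fin_two ψ' fun g ↦ ⟨_, hψ' g⟩,
    fun g ↦ ?_, fun g hg ↦ ?_⟩
  · -- same characteristic polynomial: compare trace and determinant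
    rw [Matrix.charpoly_fin_two, Matrix.charpoly_fin_two, hψ']
    have htr : (Matrix.diagonal ![χ g, ((ψ g : GL (Fin 2) k) : Matrix (Fin 2) (Fin 2) k).det * (χ g)⁻¹]).trace =
        ((ψ g : GL (Fin 2) k) : Matrix (Fin 2) (Fin 2) k).trace := by
      rw [Matrix.trace_fin_two]
      simp only [Matrix.diagonal_apply_eq, Matrix.cons_val_zero, Matrix.cons_val_one]
      have h1 := hroot g
      have hinv : χ g * (χ g)⁻¹ = 1 := mul_inv_cancel₀ (hχne g)
      linear_combination (χ g)⁻¹ * h1 -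
        (χ g - ((ψ g : GL (Fin 2) k) : Matrix (Fin 2) (Fin 2) k).trace) * hinv
    have hdet : (Matrix.diagonal ![χ g, ((ψ g : GL (Fin 2) k) : Matrix (Fin 2) (Fin 2) k).det * (χ g)⁻¹]).det =
        ((ψ g : GL (Fin 2) k) : Matrix (Fin 2) (Fin 2) k).det := by
      rw [Matrix.det_diagonal, Fin.prod_univ_two]
      simp only [Matrix.cons_val_zero, Matrix.cons_val_one]
      rw [← mul_assoc, mul_comm (χ g), mul_assoc, mul_inv_cancel₀ (hχne g), mul_one]
    rw [htr, hdet]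
  · -- kernel
    rw [MonoidHom.mem_ker] at hg ⊢
    have hχg : χ g = 1 := by
      apply smul_left_injective k hw0
      change χ g • w = (1 : k) • w
      rw [hχ, hRapply, hg, Units.val_one, Matrix.one_mulVec, one_smul]
    refine Units.ext ?_
    rw [hψ', hχg, hg, Units.val_one, Matrix.det_one, inv_one, mul_one, ← Matrix.diagonal_one]
    congr 1
    ext i; fin_cases i <;> rfl

end Semisimplification

end Literature.RepresentationTheory.Semisimple
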